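import Summits.Ventures.PercRepro.RankLevelSetExplicitLin2KeyL

/-!
# PercRepro — THE LEVEL-14 THEOREM-M ROW OF C-025: THE KEY AT `p = 18 505` (p4, S4 feed)

`proofs/P4-gen18.md`. With THEOREM M's staircase multiplicity the assembled inequality `(P_d)` holds, exactly evaluated, at EVERY
core corank `15 ≤ d ≤ 16398` from `p = 4 093` (it fails at `p = 4 092`, corank `15`; the quartic floor is `36 535`, the
saturated one `181 515`). The row is taken at `p = 18 505` = the Chernoff tail `⌈(9(14 + 2^14) + 17·14 + 216)/8⌉` of
RankLevelSetExplicitLin2LevelTail, which now binds: the key `KeyL 14 18505 d` (RankLevelSetExplicitLin2KeyL) is checked by the kernel at the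
16 384 coranks (`decide`, 4 chunks of 4 096). The level step and the unconditional chain are
RankLevelSetExplicitLin2IndepFloor (`c025_fourteen_indep_step`, `c025_fourteen_indep_from_18505`). Axioms: standard.
-/

namespace PercRepro

namespace ThmN

namespace Explicit

/-- The THEOREM-M key row at `(q, p) = (14, 18 505)`, chunk 1 of 4: coranks `15 … 4110`, by the kernel. -/
theorem key_fourteen_indep_row_1 : ∀ t < 4096, KeyL 14 18505 (15 + t) := by decide +kernel

/-- The THEOREM-M key row at `(q, p) = (14, 18 505)`, chunk 2 of 4: coranks `4111 … 8206`, by the kernel. -/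
theorem key_fourteen_indep_row_2 : ∀ t < 4096, KeyL 14 18505 (15 + (4096 + t)) := by decide +kernel

/-- The THEOREM-M key row at `(q, p) = (14, 18 505)`, chunk 3 of 4: coranks `8207 … 12302`, by the kernel. -/
theorem key_fourteen_indep_row_3 : ∀ t < 4096, KeyL 14 18505 (15 + (8192 + t)) := by decide +kernel

/-- The THEOREM-M key row at `(q, p) = (14, 18 505)`, chunk 4 of 4: coranks `12303 … 16398`, by the kernel. -/
theorem key_fourteen_indep_row_4 : ∀ t < 4096, KeyL 14 18505 (15 + (12288 + t)) := by decide +kernel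

/-- **THE THEOREM-M KEY ROW AT `(q, p) = (14, 18 505)`**: `KeyL 14 18505 d` at every corank `15 ≤ d ≤ 16398` (the 4 chunks). -/
theorem key_fourteen_indep_row : ∀ t < 16384, KeyL 14 18505 (15 + t) :=
  ball_lt_add (fun t => KeyL 14 18505 (15 + t)) 12288 4096
    (ball_lt_add (fun t => KeyL 14 18505 (15 + t)) 8192 4096
    (ball_lt_add (fun t => KeyL 14 18505 (15 + t)) 4096 4096
    (key_fourteen_indep_row_1) key_fourteen_indep_row_2) key_fourteen_indep_row_3) key_fourteen_indep_row_4

/-- **THE KEY'S OWN FLOOR IS `4 093`**: the THEOREM-M key FAILS at `p = 4 092`, corank `15`, by the kernel (the row sits at the tail `18 505`). -/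
theorem key_fourteen_indep_sharp : ¬ KeyL 14 4092 15 := by decide +kernel

end Explicit

end ThmN

end PercRepro
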